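import Summits.Ventures.AbcSig.Rows.Statements
import Summits.Ventures.AbcSig.Rows.XnYn55Z2EvenX

/-!
# Venture AbcSig — CELL bridge for `xⁿ + yⁿ = 55 z²`, `xy` even: p1's census predicate `Rows.C1CellEven 55 11 ∅`

HONEST FRAMING. COMPUTATION cell `pub-abcsig`; CONDITIONAL theorem; no claim on ABC or any summit. Hypotheses exactly
those of `Rows/XnYn55Z2EvenX.lean` (`xrow_XnYn55Z2Even`): `BS04Package` (CITED), `DataComplete` /
`Refines` (COMPUTED, certified level files), and the row's per-orbit CITED exclusions `hX_…` universally quantified in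
the exponent. Conclusion = the census statement of the SIGNED row of record `census/rows/C1/C1-C55-even.md` in p1's
vocabulary (`Rows/Statements.lean`): every prime `n ≥ 11`, `n ∤ 55`, no primitive solution with `xy` even.
GENERATED by p-lean gen3/make_c1cell.py (pattern of `Rows/BridgeC1P2.lean`).
-/

namespace Summit.Ventures.AbcSig

/-- `xⁿ + yⁿ = 55z²`, `xy` even, every prime `n ≥ 11` with `n ∤ 55`: p1's `Rows.C1CellEven 55 11 ∅` from `xrow_XnYn55Z2Even`. -/
theorem C1CellEven_55_of (M : NewformModel) (hP : M.BS04Package)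
    (hK13 : M.RefinedTraces (fun S => S.A = 1 ∧ S.B = 1 ∧ S.C = 55 ∧ S.n = 13 ∧ 2 ∣ S.a * S.b) krausTab_C55e_n13)
    (hD6050 : M.DataComplete 6050 level6050Orbits)
    (hRk_orbit_6050_22 : M.Refines 6050 orbit_6050_22 m4kX_6050_22)
    (hRk_orbit_6050_23 : M.Refines 6050 orbit_6050_23 m4kX_6050_23)
    (hRk_orbit_6050_24 : M.Refines 6050 orbit_6050_24 m4kX_6050_24)
    (hRk_orbit_6050_25 : M.Refines 6050 orbit_6050_25 m4kX_6050_25)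
    (hX_orbit_6050_9 : ∀ n : ℕ, M.Excludes 6050 orbit_6050_9 (fun S => S.A = 1 ∧ S.B = 1 ∧ S.C = 55 ∧ S.n = n ∧ 2 ∣ S.a * S.b))
    (hX_orbit_6050_35 : ∀ n : ℕ, M.Excludes 6050 orbit_6050_35 (fun S => S.A = 1 ∧ S.B = 1 ∧ S.C = 55 ∧ S.n = n ∧ 2 ∣ S.a * S.b))
    (hX_orbit_6050_37 : ∀ n : ℕ, M.Excludes 6050 orbit_6050_37 (fun S => S.A = 1 ∧ S.B = 1 ∧ S.C = 55 ∧ S.n = n ∧ 2 ∣ S.a * S.b))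
    (hX_orbit_6050_38 : ∀ n : ℕ, M.Excludes 6050 orbit_6050_38 (fun S => S.A = 1 ∧ S.B = 1 ∧ S.C = 55 ∧ S.n = n ∧ 2 ∣ S.a * S.b)) :
    Rows.C1CellEven 55 11 ∅ :=
  fun n hn h11 hC _ x y z hpar =>
    xrow_XnYn55Z2Even M hP hK13 hD6050 hRk_orbit_6050_22 hRk_orbit_6050_23 hRk_orbit_6050_24 hRk_orbit_6050_25 n hn h11 (by
      intro hmem
      simp only [List.mem_cons, List.not_mem_nil, or_false] at hmem
      subst hmem
      exact hC (by norm_num)) (hX_orbit_6050_9 n) (hX_orbit_6050_35 n) (hX_orbit_6050_37 n) (hX_orbit_6050_38 n) x y z hpar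

end Summit.Ventures.AbcSig
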